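import Mathlib.Analysis.SpecialFunctions.Gamma.Basic
import Mathlib.Analysis.SpecialFunctions.Gaussian.GaussianIntegral
import Mathlib.Analysis.MeanInequalities
import Mathlib.MeasureTheory.Group.LIntegral
import Mathlib.MeasureTheory.Measure.Haar.Unique
import Mathlib.Topology.Algebra.InfiniteSum.NatInt

/-!
# Stub K2 (`envelopeUpgrade`) for `PerpetualPump.Thesis`, part I: dyadic–parabolic calculus

Support file (part 1 of the stub `envelopeUpgrade` of line `SketchIdeator2`, crux
stmt-NavierStokesRegularity-1832). The envelope upgrade says that along an `H¹⁰_df`-mild solution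
`u` of an averaged Navier–Stokes equation (T. Tao, J. Amer. Math. Soc. 29 (2016), (1.15)) an `L^∞`
Type-I bound `‖u(t)‖_∞ ≤ M (T-t)^{-1/2}` forces a Type-I bound of the Besov envelope
`‖u(t)‖_{Ḃ⁰_{∞,1}} = ∑_k ‖Δ̇_k u(t)‖_∞ ≤ M' (T-t)^{-1/2}`. The proof (parts II–III) reads each block
of the Duhamel term through the blockwise estimate of stub F_A,
`‖Δ̇_k ∫_0^t e^{(t-s)Δ} B̃(u,u)(s) ds‖_∞ ≤ 3K ∫_0^t ‖u(s)‖²_{Ḃ⁰_{∞,1}} 2ᵏ e^{-c(t-s)4ᵏ} ds`, feeds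
it with the self-similar majorant `‖u(s)‖_{Ḃ⁰_{∞,1}} ≤ A (T-s)^{-1/2}`, caps the hot blocks by the
a-priori `L^∞` bound and sums over `k`. This file supplies the two real-variable ingredients:

* `K2.lintegral_inv_mul_dyadicHeat_le`: **the singular time integral at frequency `2ᵏ`**,
  `∫_{t₁}^{t} (T-s)^{-1} 2ᵏ e^{-κ(t-s)4ᵏ} ds ≤ Γ(θ) (T-t)^{-θ} 2ᵏ (κ 4ᵏ)^{-θ}` for every
  `θ ∈ (0,1]` (weighted AM–GM `(D+τ)^{-1} ≤ D^{-θ}τ^{θ-1}` and the Gamma integral); the cases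
  `θ = 1` (above the front `2ᵏ ≳ (T-t)^{-1/2}`) and `θ = 1/4` (below it) give a two-sided decaying
  ("tent") profile in `k` centred at the front;
* `K2.tsum_tent_le`: **two-sided geometric sums anchored at a real scale**,
  `∑_{k ∈ ℤ} min(λᵏ r, (λᵏ r)^{-1}) ≤ 2 (1 - λ^{-1})^{-1}` uniformly in `r > 0` (`λ > 1`).

## References

* T. Tao, J. Amer. Math. Soc. 29 (2016), 601–674, §1.1.
* H. Bahouri, J.-Y. Chemin, R. Danchin, *Fourier Analysis and Nonlinear PDE* (2011), §2.1, Lemma 2.4.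
-/

noncomputable section

open MeasureTheory Set Filter Topology
open scoped ENNReal NNReal

set_option linter.dupNamespace false

namespace Summit.NavierStokesRegularity.NavierStokesRegularity.Theorems.PerpetualPumpThesis.K2

/-! ### Weighted AM–GM: `(D + τ)⁻¹ ≤ D^{-θ} τ^{θ-1}` -/

/-- **`(D + τ)⁻¹ ≤ D^{-θ} τ^{θ-1}`** for `D, τ > 0` and `0 < θ ≤ 1` (weighted AM–GM
`D^θ τ^{1-θ} ≤ θ D + (1-θ) τ ≤ D + τ`). -/
theorem inv_add_le_rpow_mul_rpow {D τ θ : ℝ} (hD : 0 < D) (hτ : 0 < τ) (hθ : 0 < θ)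
    (hθ1 : θ ≤ 1) : (D + τ)⁻¹ ≤ D ^ (-θ) * τ ^ (θ - 1) := by
  have hgm : D ^ θ * τ ^ (1 - θ) ≤ θ * D + (1 - θ) * τ :=
    Real.geom_mean_le_arith_mean2_weighted hθ.le (by linarith) hD.le hτ.le (by ring)
  have hle : D ^ θ * τ ^ (1 - θ) ≤ D + τ := by
    refine hgm.trans ?_
    nlinarith [mul_nonneg (by linarith : (0 : ℝ) ≤ 1 - θ) hD.le, mul_nonneg hθ.le hτ.le]
  have hpos : 0 < D ^ θ * τ ^ (1 - θ) := mul_pos (Real.rpow_pos_of_pos hD _) (Real.rpow_pos_of_pos hτ _)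
  calc (D + τ)⁻¹ ≤ (D ^ θ * τ ^ (1 - θ))⁻¹ := inv_anti₀ hpos hle
    _ = D ^ (-θ) * τ ^ (θ - 1) := by
        rw [mul_inv, ← Real.rpow_neg hD.le, ← Real.rpow_neg hτ.le, neg_sub]

/-! ### The Gamma integral as a lower Lebesgue integral -/

/-- `∫_0^∞ τ^{θ-1} e^{-rτ} dτ = r^{-θ} Γ(θ)` for `θ, r > 0`, as a lower Lebesgue integral. -/
theorem lintegral_Ioi_rpow_mul_exp_neg {θ r : ℝ} (hθ : 0 < θ) (hr : 0 < r) :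
    ∫⁻ τ in Ioi (0 : ℝ), ENNReal.ofReal (τ ^ (θ - 1) * Real.exp (-(r * τ))) =
      ENNReal.ofReal ((1 / r) ^ θ * Real.Gamma θ) := by
  have hint : IntegrableOn (fun τ : ℝ => τ ^ (θ - 1) * Real.exp (-(r * τ))) (Ioi 0) := by
    have h := integrableOn_rpow_mul_exp_neg_mul_rpow (s := θ - 1) (p := 1) (b := r)
      (by linarith) le_rfl hr
    refine h.congr_fun (fun τ _ => ?_) measurableSet_Ioi
    simp only [Real.rpow_one, neg_mul]
  rw [← Real.integral_rpow_mul_exp_neg_mul_Ioi hθ hr, ofReal_integral_eq_lintegral_ofReal hint]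
  filter_upwards [ae_restrict_mem measurableSet_Ioi] with τ hτ
  exact mul_nonneg (Real.rpow_nonneg hτ.out.le _) (Real.exp_pos _).le

/-! ### The singular time integral at frequency `2ᵏ` -/

/-- **The singular time integral at frequency `2ᵏ`.** For `0 < θ ≤ 1`, `κ > 0`, `t < T`, any `t₁`
and `k ∈ ℤ`,
`∫_{(t₁,t)} (T-s)^{-1} 2ᵏ e^{-κ (t-s) 4ᵏ} ds ≤ (T-t)^{-θ} 2ᵏ (κ 4ᵏ)^{-θ} Γ(θ)`
(pointwise `(T-s)^{-1} = ((T-t) + (t-s))^{-1} ≤ (T-t)^{-θ} (t-s)^{θ-1}`, then the reflected Gamma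
integral over all of `(0, ∞)`). -/
theorem lintegral_inv_mul_dyadicHeat_le {θ : ℝ} (hθ : 0 < θ) (hθ1 : θ ≤ 1) {κ : ℝ} (hκ : 0 < κ)
    {T t : ℝ} (htT : t < T) (t₁ : ℝ) (k : ℤ) :
    ∫⁻ s in Ioo t₁ t, ENNReal.ofReal ((T - s)⁻¹) *
        ENNReal.ofReal ((2 : ℝ) ^ k * Real.exp (-κ * ((t - s) * ((2 : ℝ) ^ k) ^ 2))) ≤
      ENNReal.ofReal ((T - t) ^ (-θ) * (2 : ℝ) ^ k *
        ((1 / (κ * ((2 : ℝ) ^ k) ^ 2)) ^ θ * Real.Gamma θ)) := by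
  set D : ℝ := T - t with hD
  have hDpos : 0 < D := sub_pos.2 htT
  set r : ℝ := κ * ((2 : ℝ) ^ k) ^ 2 with hr
  have h2k : 0 < (2 : ℝ) ^ k := zpow_pos two_pos k
  have hrpos : 0 < r := mul_pos hκ (pow_pos h2k 2)
  -- the reflected Gamma integrand
  set F : ℝ → ℝ≥0∞ := fun τ => ENNReal.ofReal (τ ^ (θ - 1) * Real.exp (-(r * τ))) with hF
  -- pointwise bound on `Ioo t₁ t`
  have hpt : ∀ s ∈ Ioo t₁ t, ENNReal.ofReal ((T - s)⁻¹) *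
      ENNReal.ofReal ((2 : ℝ) ^ k * Real.exp (-κ * ((t - s) * ((2 : ℝ) ^ k) ^ 2))) ≤
      ENNReal.ofReal (D ^ (-θ) * (2 : ℝ) ^ k) * (Ioi (0 : ℝ)).indicator F (t - s) := by
    intro s hs
    have hτ : 0 < t - s := sub_pos.2 hs.2
    rw [indicator_of_mem (mem_Ioi.2 hτ), hF]
    dsimp only
    rw [← ENNReal.ofReal_mul (inv_nonneg.2 (by linarith [hs.2])),
      ← ENNReal.ofReal_mul (by positivity)]
    refine ENNReal.ofReal_le_ofReal ?_
    have hinv : (T - s)⁻¹ ≤ D ^ (-θ) * (t - s) ^ (θ - 1) := by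
      have : T - s = D + (t - s) := by rw [hD]; ring
      rw [this]
      exact inv_add_le_rpow_mul_rpow hDpos hτ hθ hθ1
    have hexp : Real.exp (-κ * ((t - s) * ((2 : ℝ) ^ k) ^ 2)) = Real.exp (-(r * (t - s))) := by
      rw [hr]; ring_nf
    rw [hexp]
    calc (T - s)⁻¹ * ((2 : ℝ) ^ k * Real.exp (-(r * (t - s))))
        ≤ (D ^ (-θ) * (t - s) ^ (θ - 1)) * ((2 : ℝ) ^ k * Real.exp (-(r * (t - s)))) :=
          mul_le_mul_of_nonneg_right hinv (by positivity)
      _ = D ^ (-θ) * (2 : ℝ) ^ k * ((t - s) ^ (θ - 1) * Real.exp (-(r * (t - s)))) := by ring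
  calc ∫⁻ s in Ioo t₁ t, ENNReal.ofReal ((T - s)⁻¹) *
        ENNReal.ofReal ((2 : ℝ) ^ k * Real.exp (-κ * ((t - s) * ((2 : ℝ) ^ k) ^ 2)))
      ≤ ∫⁻ s in Ioo t₁ t, ENNReal.ofReal (D ^ (-θ) * (2 : ℝ) ^ k) *
          (Ioi (0 : ℝ)).indicator F (t - s) := setLIntegral_mono' measurableSet_Ioo hpt
    _ ≤ ∫⁻ s, ENNReal.ofReal (D ^ (-θ) * (2 : ℝ) ^ k) * (Ioi (0 : ℝ)).indicator F (t - s) :=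
        setLIntegral_le_lintegral _ _
    _ = ENNReal.ofReal (D ^ (-θ) * (2 : ℝ) ^ k) * ∫⁻ s, (Ioi (0 : ℝ)).indicator F (t - s) := by
        rw [lintegral_const_mul' _ _ ENNReal.ofReal_ne_top]
    _ = ENNReal.ofReal (D ^ (-θ) * (2 : ℝ) ^ k) * ∫⁻ τ, (Ioi (0 : ℝ)).indicator F τ := by
        rw [lintegral_sub_left_eq_self ((Ioi (0 : ℝ)).indicator F) t]
    _ = ENNReal.ofReal (D ^ (-θ) * (2 : ℝ) ^ k) * ENNReal.ofReal ((1 / r) ^ θ * Real.Gamma θ) := by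
        rw [lintegral_indicator measurableSet_Ioi, hF, lintegral_Ioi_rpow_mul_exp_neg hθ hrpos]
    _ = ENNReal.ofReal ((T - t) ^ (-θ) * (2 : ℝ) ^ k *
          ((1 / (κ * ((2 : ℝ) ^ k) ^ 2)) ^ θ * Real.Gamma θ)) := by
        rw [← ENNReal.ofReal_mul (by positivity)]

/-! ### Two-sided geometric ("tent") sums anchored at a real scale -/

/-- **Tent sums**: for `λ > 1` and every `r > 0`,
`∑_{k ∈ ℤ} min(λᵏ r, (λᵏ r)⁻¹) ≤ 2 (1 - λ⁻¹)⁻¹`; the bound is uniform in the anchor `r` (choose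
`k₀` with `λ^{k₀} ≤ r⁻¹ < λ^{k₀+1}`; on either side of `k₀` the summand is below a geometric
sequence of ratio `λ⁻¹`). -/
theorem tsum_tent_le {lam : ℝ} (hlam : 1 < lam) {r : ℝ} (hr : 0 < r) :
    ∑' k : ℤ, ENNReal.ofReal (min (lam ^ k * r) (lam ^ k * r)⁻¹) ≤
      2 * (1 - ENNReal.ofReal lam⁻¹)⁻¹ := by
  have hlam0 : 0 < lam := one_pos.trans hlam
  obtain ⟨k₀, hk₀, hk₀'⟩ := exists_mem_Ico_zpow (inv_pos.2 hr) hlam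
  set f : ℤ → ℝ≥0∞ := fun k => ENNReal.ofReal (min (lam ^ k * r) (lam ^ k * r)⁻¹) with hf
  set ρ : ℝ≥0∞ := ENNReal.ofReal lam⁻¹ with hρ
  have hρpow : ∀ j : ℕ, ENNReal.ofReal ((lam ^ j)⁻¹) = ρ ^ j := by
    intro j
    rw [hρ, ← ENNReal.ofReal_pow (inv_nonneg.2 hlam0.le), inv_pow]
  -- the anchor: `y₁ = λ^{k₀+1} r > 1` and `y₀ = λ^{k₀} r ≤ 1`
  have hy1 : 1 < lam ^ (k₀ + 1) * r := by
    have h := mul_lt_mul_of_pos_right hk₀' hr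
    rwa [inv_mul_cancel₀ hr.ne'] at h
  have hy0 : lam ^ k₀ * r ≤ 1 := by
    have h := mul_le_mul_of_nonneg_right hk₀ hr.le
    rwa [inv_mul_cancel₀ hr.ne'] at h
  -- right of the anchor
  have hright : ∀ j : ℕ, f ((j : ℤ) + (k₀ + 1)) ≤ ρ ^ j := by
    intro j
    have hsplit : lam ^ ((j : ℤ) + (k₀ + 1)) * r = lam ^ j * (lam ^ (k₀ + 1) * r) := by
      rw [zpow_add₀ hlam0.ne', zpow_natCast]; ring
    have hpos : 0 < lam ^ j * (lam ^ (k₀ + 1) * r) :=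
      mul_pos (pow_pos hlam0 j) (one_pos.trans hy1)
    rw [hf]
    dsimp only
    rw [hsplit, ← hρpow j]
    refine ENNReal.ofReal_le_ofReal ((min_le_right _ _).trans ?_)
    rw [mul_inv]
    calc (lam ^ j)⁻¹ * (lam ^ (k₀ + 1) * r)⁻¹ ≤ (lam ^ j)⁻¹ * 1 := by
          gcongr
          exact inv_le_one_of_one_le₀ hy1.le
      _ = (lam ^ j)⁻¹ := mul_one _
  -- left of the anchor
  have hleft : ∀ j : ℕ, f (-((j : ℤ) + 1) + (k₀ + 1)) ≤ ρ ^ j := by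
    intro j
    have hidx : -((j : ℤ) + 1) + (k₀ + 1) = k₀ - j := by ring
    have hsplit : lam ^ (k₀ - (j : ℤ)) * r = (lam ^ j)⁻¹ * (lam ^ k₀ * r) := by
      rw [zpow_sub₀ hlam0.ne', zpow_natCast]; ring
    rw [hf]
    dsimp only
    rw [hidx, hsplit, ← hρpow j]
    refine ENNReal.ofReal_le_ofReal ((min_le_left _ _).trans ?_)
    calc (lam ^ j)⁻¹ * (lam ^ k₀ * r) ≤ (lam ^ j)⁻¹ * 1 := by gcongr
      _ = (lam ^ j)⁻¹ := mul_one _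
  have hgeom : ∑' j : ℕ, ρ ^ j = (1 - ρ)⁻¹ := ENNReal.tsum_geometric ρ
  calc ∑' k : ℤ, f k = ∑' k : ℤ, f (k + (k₀ + 1)) :=
        ((Equiv.addRight (k₀ + 1)).tsum_eq f).symm
    _ = ∑' j : ℕ, f ((j : ℤ) + (k₀ + 1)) + ∑' j : ℕ, f (-((j : ℤ) + 1) + (k₀ + 1)) :=
        tsum_of_nat_of_neg_add_one (f := fun k : ℤ => f (k + (k₀ + 1)))
          ENNReal.summable ENNReal.summable
    _ ≤ ∑' j : ℕ, ρ ^ j + ∑' j : ℕ, ρ ^ j :=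
        add_le_add (ENNReal.tsum_le_tsum hright) (ENNReal.tsum_le_tsum hleft)
    _ = 2 * (1 - ENNReal.ofReal lam⁻¹)⁻¹ := by rw [hgeom, hρ, two_mul]

/-- The tent-sum constant is finite: `2 (1 - λ⁻¹)⁻¹ < ∞` for `λ > 1`. -/
theorem tent_const_lt_top {lam : ℝ} (hlam : 1 < lam) :
    2 * (1 - ENNReal.ofReal lam⁻¹)⁻¹ < ⊤ := by
  refine ENNReal.mul_lt_top (by simp) (ENNReal.inv_lt_top.2 (tsub_pos_of_lt ?_))
  rw [← ENNReal.ofReal_one]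
  exact (ENNReal.ofReal_lt_ofReal_iff one_pos).2 (inv_lt_one_of_one_lt₀ hlam)

end Summit.NavierStokesRegularity.NavierStokesRegularity.Theorems.PerpetualPumpThesis.K2

namespace Summit.NavierStokesRegularity.NavierStokesRegularity.Theorems.PerpetualPumpThesis

/-- **Part Dyadic of stub K2 `envelopeUpgrade` (registered sub-goal `stub_K2_Dyadic`)**: (i) the
singular time integral at frequency `2ᵏ`,
`∫_{(t₁,t)} (T-s)^{-1} 2ᵏ e^{-κ(t-s)4ᵏ} ds ≤ (T-t)^{-θ} 2ᵏ (κ4ᵏ)^{-θ} Γ(θ)` for `0 < θ ≤ 1`, and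
(ii) the anchored tent sums `∑_{k ∈ ℤ} min(λᵏ r, (λᵏ r)⁻¹) ≤ 2(1 - λ⁻¹)⁻¹` for `λ > 1`, `r > 0`. -/
theorem stub_K2_Dyadic : (∀ (θ : ℝ), 0 < θ → θ ≤ 1 → ∀ (κ : ℝ), 0 < κ → ∀ (T t : ℝ), t < T → ∀ (t₁ : ℝ) (k : ℤ), ∫⁻ s in Ioo t₁ t, ENNReal.ofReal ((T - s)⁻¹) * ENNReal.ofReal ((2 : ℝ) ^ k * Real.exp (-κ * ((t - s) * ((2 : ℝ) ^ k) ^ 2))) ≤ ENNReal.ofReal ((T - t) ^ (-θ) * (2 : ℝ) ^ k * ((1 / (κ * ((2 : ℝ) ^ k) ^ 2)) ^ θ * Real.Gamma θ))) ∧ ∀ (lam : ℝ), 1 < lam → ∀ (r : ℝ), 0 < r → ∑' k : ℤ, ENNReal.ofReal (min (lam ^ k * r) (lam ^ k * r)⁻¹) ≤ 2 * (1 - ENNReal.ofReal lam⁻¹)⁻¹ :=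
  ⟨fun _θ hθ hθ1 _κ hκ _T _t htT t₁ k => K2.lintegral_inv_mul_dyadicHeat_le hθ hθ1 hκ htT t₁ k,
    fun _lam hlam _r hr => K2.tsum_tent_le hlam hr⟩

end Summit.NavierStokesRegularity.NavierStokesRegularity.Theorems.PerpetualPumpThesis

end
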